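import Mathlib
import Literature.MathematicalPhysics.StatisticalMechanics.Crystallization
import Literature.MathematicalPhysics.StatisticalMechanics.StickyChainCrystallization
import Literature.MathematicalPhysics.StatisticalMechanics.PeriodicConfigurationSums
import Literature.Algebra.EuclideanLattices.IntegerBases

/-!
# Crux `ExactCertificate` (stmt-AtomisticToContinuum-11959), line `closure-makes-nogap-exact`,
# Transfer1D skeleton (`ExactCertificate1D`): the stub `stub_chain`

Support file — nothing here closes an item.  The d = 1 transfer skeleton of the crux
`ThreeConeCertificate.ExactCertificate` tests every competitor against the template chain
`aℤ ⊂ ℝ¹` (`a > 0` the lattice constant).  This file supplies the bookkeeping stub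

`stub_chain : ∀ a > 0, ∃ P : PeriodicConfiguration 1, e_V(P) = Σ_{k ≥ 0} V((k+1)a)`, `V = lennardJones`:

the chain `aℤ` is a periodic (Bravais) configuration of the line — lattice of periods `aℤ¹`,
realised as the Mathlib pull-back `ZLattice.comap` of `ℤ¹ = stdIntLattice 1` along the continuous
linear equivalence `x ↦ a⁻¹ • x` (which supplies the `DiscreteTopology`/`IsZLattice` instances),
one-point motif `{0}` — and its Lennard-Jones energy per particle
`e_V(aℤ) = ½ Σ_{k ∈ ℤ ∖ 0} V(|k| a)` is `Σ_{m ≥ 1} V(m a)`: reindex the lattice `tsum` by the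
nonzero integers (`k ↦ k a e₀`), extend to all of `ℤ` (`V(0) = 0` by `0⁻¹ = 0`), and split the
`ℤ`-sum into its two halves (`tsum_of_add_one_of_neg_add_one`), each equal to `Σ_{m ≥ 1} V(m a)`;
the summability needed for the split is transported from
`PeriodicConfiguration.summable_lennardJones_dist` (`d = 1 < 6`).  All `[folklore]`.
-/

noncomputable section

namespace Summit.AtomisticToContinuum.Crystallization.Theorems.ThreeConeCertificateExactCertificate.Transfer1D

open Literature.MathematicalPhysics.StatisticalMechanics
open Literature.Algebra.EuclideanLattices StickyChain

/-- **The chain `aℤ ⊂ ℝ¹` and its Lennard-Jones energy per particle.**  For every `a > 0` the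
chain `aℤ` is a periodic configuration of the line (lattice of periods `aℤ¹`, motif `{0}`) whose
Lennard-Jones energy per particle is `e_V(aℤ) = ½ Σ_{k ≠ 0} V(|k| a) = Σ_{m ≥ 1} V(m a)`
(Blanc–Lewin 2015, (23), in `d = 1`). [folklore] -/
theorem stub_chain : ∀ a : ℝ, 0 < a → ∃ P : PeriodicConfiguration 1,
    P.energyPerParticle lennardJones = ∑' k : ℕ, lennardJones (((k : ℝ) + 1) * a) := by
  intro a ha
  have ha0 : a ≠ 0 := ha.ne'
  -- the continuous linear equivalence `x ↦ a⁻¹ • x`, along which `ℤ¹` is pulled back to `aℤ¹`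
  let e : EuclideanSpace ℝ (Fin 1) ≃L[ℝ] EuclideanSpace ℝ (Fin 1) :=
    (LinearEquiv.smulOfNeZero ℝ (EuclideanSpace ℝ (Fin 1)) a⁻¹
      (inv_ne_zero ha0)).toContinuousLinearEquiv
  -- the chain `aℤ`: lattice of periods `aℤ¹`, motif `{0}`
  let Q : PeriodicConfiguration 1 :=
    { lattice := ZLattice.comap ℝ (stdIntLattice 1) e.toLinearMap
      discrete := inferInstance
      isZLattice := inferInstance
      motif := {0}
      motif_nonempty := ⟨0, Finset.mem_singleton_self 0⟩
      eq_of_sub_mem := fun x hx y hy _ => by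
        rw [Finset.mem_singleton.1 hx, Finset.mem_singleton.1 hy] }
  -- membership in the lattice of periods: `g ∈ aℤ¹ ↔ g₀ ∈ aℤ`
  have hlat : ∀ g : EuclideanSpace ℝ (Fin 1), g ∈ Q.lattice ↔ ∃ k : ℤ, (k : ℝ) * a = g 0 := by
    intro g
    have h1 : g ∈ Q.lattice ↔ a⁻¹ • g ∈ stdIntLattice 1 := by
      show g ∈ ZLattice.comap ℝ (stdIntLattice 1) _ ↔ _
      rw [ZLattice.comap, Submodule.mem_comap]
      rfl
    rw [h1, mem_stdIntLattice_iff]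
    constructor
    · intro h
      obtain ⟨k, hk⟩ := h 0
      rw [PiLp.smul_apply, smul_eq_mul] at hk
      exact ⟨k, by rw [hk]; field_simp⟩
    · rintro ⟨k, hk⟩ j
      obtain rfl : j = 0 := Fin.fin_one_eq_zero j
      refine ⟨k, ?_⟩
      rw [PiLp.smul_apply, smul_eq_mul, ← hk]
      field_simp
  -- membership in the point set (motif `{0}`: the points are the periods)
  have hpts : ∀ z : EuclideanSpace ℝ (Fin 1), z ∈ Q.points ↔ ∃ k : ℤ, (k : ℝ) * a = z 0 := by
    intro z
    constructor
    · rintro ⟨y, hy, g, hg, rfl⟩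
      have hy0 : y = 0 := Finset.mem_singleton.1 hy
      obtain ⟨k, hk⟩ := (hlat g).1 hg
      exact ⟨k, by rw [hy0, zero_add, hk]⟩
    · rintro ⟨k, hk⟩
      exact ⟨0, Finset.mem_singleton_self 0, z, (hlat z).2 ⟨k, hk⟩, (zero_add z).symm⟩
  -- the summand on `ℤ`: `k ↦ V(|k| a)`, vanishing at `k = 0`
  set G : ℤ → ℝ := fun k => lennardJones (|(k : ℝ)| * a) with hG
  have hG0 : G 0 = 0 := by simp [hG, lennardJones]
  have hpos : ∀ n : ℕ, G ((n : ℤ) + 1) = lennardJones (((n : ℝ) + 1) * a) := fun n => by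
    simp only [hG]
    push_cast
    rw [abs_of_nonneg (by positivity)]
  have hneg : ∀ n : ℕ, G (-((n : ℤ) + 1)) = lennardJones (((n : ℝ) + 1) * a) := fun n => by
    simp only [hG]
    push_cast
    rw [abs_neg, abs_of_nonneg (by positivity)]
  -- the points of the chain other than `0` are the `k a e₀`, `k ∈ ℤ ∖ 0`
  have hmem : ∀ k : ℤ, k ≠ 0 →
      (EuclideanSpace.single 0 ((k : ℝ) * a) : EuclideanSpace ℝ (Fin 1)) ∈ Q.points ∧
        (EuclideanSpace.single 0 ((k : ℝ) * a) : EuclideanSpace ℝ (Fin 1)) ≠ 0 := fun k hk =>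
    ⟨(hpts _).2 ⟨k, by simp⟩, fun h => by simp [ha0, hk] at h⟩
  let ε : {k : ℤ // k ≠ 0} → {y // y ∈ Q.points ∧ y ≠ 0} := fun k =>
    ⟨EuclideanSpace.single 0 ((k.1 : ℝ) * a), hmem k.1 k.2⟩
  have hε : Function.Bijective ε := by
    constructor
    · intro k k' h
      have h1 : (k.1 : ℝ) * a = (k'.1 : ℝ) * a := by
        have := congrArg (fun y : {y // y ∈ Q.points ∧ y ≠ 0} => y.1 0) h
        simpa [ε] using this
      exact Subtype.ext (by exact_mod_cast mul_right_cancel₀ ha0 h1)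
    · intro y
      obtain ⟨k, hk⟩ := (hpts y.1).1 y.2.1
      have hk0 : k ≠ 0 := by
        rintro rfl
        refine y.2.2 (ext_zero ?_)
        rw [← hk, PiLp.zero_apply]
        simp
      refine ⟨⟨k, hk0⟩, Subtype.ext (ext_zero ?_)⟩
      simpa [ε] using hk
  let εE : {k : ℤ // k ≠ 0} ≃ {y // y ∈ Q.points ∧ y ≠ 0} := Equiv.ofBijective ε hε
  have hdist : ∀ k : {k : ℤ // k ≠ 0},
      lennardJones (dist (0 : EuclideanSpace ℝ (Fin 1)) (εE k).1) = G k.1 := fun k => by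
    simp only [εE, Equiv.ofBijective_apply, ε, hG]
    congr 1
    rw [dist_eq_abs_sub, PiLp.zero_apply, PiLp.single_apply, if_pos rfl, zero_sub, abs_neg, abs_mul,
      abs_of_pos ha]
  -- step 1: reindex the lattice sum by the nonzero integers
  have h1 : ∑' y : {y // y ∈ Q.points ∧ y ≠ 0}, lennardJones (dist (0 : EuclideanSpace ℝ (Fin 1)) y.1)
      = ∑' k : {k : ℤ // k ≠ 0}, G k.1 := by
    rw [← Equiv.tsum_eq εE]
    exact tsum_congr hdist
  -- step 2: extend to all of `ℤ` (`G 0 = V 0 = 0`)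
  have h2 : ∑' k : {k : ℤ // k ≠ 0}, G k.1 = ∑' k : ℤ, G k :=
    tsum_subtype_eq_of_support_subset (s := {k : ℤ | k ≠ 0}) (by
      rintro k hk rfl
      exact hk hG0)
  -- summability of `m ↦ V(m a)`, transported from the lattice sum of `Q`
  have hS : Summable fun n : ℕ => lennardJones (((n : ℝ) + 1) * a) := by
    have h := (εE.summable_iff).2 (Q.summable_lennardJones_dist (by norm_num) 0)
    have h' : Summable fun k : {k : ℤ // k ≠ 0} => G k.1 := h.congr hdist
    have hj : Function.Injective fun n : ℕ => (⟨(n : ℤ) + 1, by omega⟩ : {k : ℤ // k ≠ 0}) :=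
      fun m n h => by simpa using congrArg Subtype.val h
    exact (h'.comp_injective hj).congr fun n => hpos n
  -- step 3: split the `ℤ`-sum into its two halves
  have h3 : ∑' k : ℤ, G k = 2 * ∑' k : ℕ, lennardJones (((k : ℝ) + 1) * a) := by
    rw [tsum_of_add_one_of_neg_add_one (f := G) (by simpa only [hpos] using hS)
      (by simpa only [hneg] using hS)]
    simp only [hpos, hneg, hG0]
    ring
  -- assemble: `e_V(aℤ) = ½ Σ'_{y ≠ 0} V(dist 0 y)`
  refine ⟨Q, ?_⟩
  unfold PeriodicConfiguration.energyPerParticle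
  rw [show Q.motif = {0} from rfl, Finset.sum_singleton, Finset.card_singleton, h1, h2, h3]
  push_cast
  ring

end Summit.AtomisticToContinuum.Crystallization.Theorems.ThreeConeCertificateExactCertificate.Transfer1D

end
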